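import Literature.MathematicalPhysics.KineticTheory.HardSphereEulerLLN
import Literature.MathematicalPhysics.KineticTheory.HardSphereEulerProofs
import Literature.MathematicalPhysics.KineticTheory.HardSphereEulerDim
import Literature.MathematicalPhysics.KineticTheory.HardSphereEulerContinuation
import Literature.Analysis.FunctionSpaces.TorusSpaceTimeComposition
import Literature.Analysis.FunctionSpaces.TorusCalculusProofs
import Mathlib.Analysis.SpecialFunctions.SmoothTransition
import HarnessLib

/-!
# PreShockDoor · part C — helper lemmas for the assembly of the door

Third landing part of the PreShockDoor node (decomp-a2c lens-1 g40): time-`0` congruence of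
`TendstoHydroFieldsAt`, extrema / integral comparison on `𝕋³`, convex combinations, two-chart
gluing of smoothness, the plateau functions `mfun`, `lfun`, monotonicity of two-sided inverses, the two-chart smoothness of the
plateau-glued family (`family_contDiffOn`) and the LLN clause of one member (`lln_member`); plus
three small arithmetic helpers extracted from the kernel to honour the 400-line convention. 0 sorry.
-/

noncomputable section

open Set Filter MeasureTheory
open scoped Topology ContDiff ENNReal
open Literature.MathematicalPhysics.KineticTheory Literature.Analysis.FunctionSpaces

namespace Summit.AtomisticToContinuum.HydrodynamicLimit.Theorems.PreShockDoor

/-! ## Helper lemmas for the assembly -/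

/-- `TendstoHydroFieldsAt … 0` only sees the time-`0` slices. -/
theorem tendstoHydroFieldsAt_zero_congr {σ : ℝ}
    {Φ : (N : ℕ) → Literature.Analysis.FluidPDE.HardSphereFlow
      (Literature.Analysis.FluidPDE.Torus.geometry (Fin 3)) (hsDiameter σ N) (N + 1)}
    {P : (N : ℕ) → Measure (Literature.Analysis.FluidPDE.Config (N + 1) (Fin 3) T3)}
    {ρ θ ρ' θ' : ℝ → T3 → ℝ} {u u' : ℝ → T3 → V3}
    (h : TendstoHydroFieldsAt P Φ ρ u θ 0) (hρ : ρ' 0 = ρ 0) (hu : u' 0 = u 0) (hθ : θ' 0 = θ 0) :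
    TendstoHydroFieldsAt P Φ ρ' u' θ' 0 := by
  intro χ hχ δ hδ
  rw [hρ, hu, hθ]
  exact h χ hχ δ hδ

/-- A continuous function on `𝕋³` attains its bounds. -/
theorem exists_min_max {f : T3 → ℝ} (hf : Continuous f) :
    ∃ xlo xhi : T3, ∀ x, f xlo ≤ f x ∧ f x ≤ f xhi := by
  obtain ⟨xlo, -, hlo⟩ := isCompact_univ.exists_isMinOn univ_nonempty hf.continuousOn
  obtain ⟨xhi, -, hhi⟩ := isCompact_univ.exists_isMaxOn univ_nonempty hf.continuousOn
  exact ⟨xlo, xhi, fun x => ⟨(isMinOn_iff.mp hlo) x (mem_univ x), (isMaxOn_iff.mp hhi) x (mem_univ x)⟩⟩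

/-- Strict comparison of integrals of continuous functions on `𝕋³`. -/
theorem integral_lt_of_forall_lt {f g : T3 → ℝ} (hf : Continuous f) (hg : Continuous g)
    (hlt : ∀ x, f x < g x) : ∫ x, f x < ∫ x, g x := by
  have hpos : 0 < ∫ x, (g x - f x) :=
    integral_pos_of_continuous_pos (hg.sub hf) fun x => sub_pos.2 (hlt x)
  rw [integral_sub (integrable_of_continuous_T3 hg) (integrable_of_continuous_T3 hf)] at hpos
  linarith

/-- A continuous unit-mass density on `𝕋³` takes the value `1` between its extrema. -/
theorem min_le_one_le_max {f : T3 → ℝ} (hf : Continuous f) (h1 : ∫ x, f x = 1) {xlo xhi : T3}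
    (hb : ∀ x, f xlo ≤ f x ∧ f x ≤ f xhi) : f xlo ≤ 1 ∧ 1 ≤ f xhi := by
  constructor
  · by_contra h
    push Not at h
    have := integral_lt_of_forall_lt continuous_const hf fun x => h.trans_le (hb x).1
    simp [h1] at this
  · by_contra h
    push Not at h
    have := integral_lt_of_forall_lt hf continuous_const fun x => (hb x).2.trans_lt h
    simp [h1] at this

/-- Convex combinations of `1` and a positive number are positive. -/
theorem convexComb_pos {m v : ℝ} (h0 : 0 ≤ m) (h1 : m ≤ 1) (hv : 0 < v) : 0 < (1 - m) + m * v := by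
  rcases h0.eq_or_lt with h | h
  · rw [← h]; norm_num
  · nlinarith [mul_pos h hv]

/-- Convex combinations of `1` and `v` stay in any interval containing `1` and `v`. -/
theorem convexComb_mem {m v lo hi : ℝ} (h0 : 0 ≤ m) (h1 : m ≤ 1) (hlo : lo ≤ v) (hhi : v ≤ hi)
    (hlo1 : lo ≤ 1) (hhi1 : 1 ≤ hi) : lo ≤ (1 - m) + m * v ∧ (1 - m) + m * v ≤ hi := by
  constructor
  · nlinarith [mul_nonneg (sub_nonneg.2 h1) (sub_nonneg.2 hlo1), mul_nonneg h0 (sub_nonneg.2 hlo)]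
  · nlinarith [mul_nonneg (sub_nonneg.2 h1) (sub_nonneg.2 hhi1), mul_nonneg h0 (sub_nonneg.2 hhi)]

/-- Local gluing of smoothness: a function that agrees with a smooth `g₁` on `{κ < 3/4}` and with
a smooth `g₂` on `{1/2 < κ}` (within `D`) is smooth within `D`. -/
theorem contDiffOn_of_two_charts {E X : Type*} [NormedAddCommGroup E] [NormedSpace ℝ E]
    [NormedAddCommGroup X] [NormedSpace ℝ X] {f g₁ g₂ : ℝ × E → X} {D : Set (ℝ × E)}
    (h₁ : ContDiffOn ℝ ∞ g₁ D) (h₂ : ContDiffOn ℝ ∞ g₂ D)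
    (hf₁ : ∀ q ∈ D, q.1 < 3 / 4 → f q = g₁ q) (hf₂ : ∀ q ∈ D, 1 / 2 < q.1 → f q = g₂ q) :
    ContDiffOn ℝ ∞ f D := by
  intro q hq
  by_cases hlt : q.1 < 3 / 4
  · have hO : {p : ℝ × E | p.1 < 3 / 4} ∈ 𝓝 q :=
      (isOpen_lt continuous_fst continuous_const).mem_nhds hlt
    have hev : f =ᶠ[𝓝[D] q] g₁ :=
      Filter.mem_of_superset (Filter.inter_mem (mem_nhdsWithin_of_mem_nhds hO) self_mem_nhdsWithin)
        fun p hp => hf₁ p hp.2 hp.1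
    exact (h₁ q hq).congr_of_eventuallyEq hev (hf₁ q hq hlt)
  · have hgt : 1 / 2 < q.1 := by push Not at hlt; linarith
    have hO : {p : ℝ × E | 1 / 2 < p.1} ∈ 𝓝 q :=
      (isOpen_lt continuous_const continuous_fst).mem_nhds hgt
    have hev : f =ᶠ[𝓝[D] q] g₂ :=
      Filter.mem_of_superset (Filter.inter_mem (mem_nhdsWithin_of_mem_nhds hO) self_mem_nhdsWithin)
        fun p hp => hf₂ p hp.2 hp.1
    exact (h₂ q hq).congr_of_eventuallyEq hev (hf₂ q hq hgt)

/-- The plateau function `m(κ) = ST(4κ - 1)`: smooth, `[0,1]`-valued, `0` at `0`, `1` on `[1/2, ∞)`. -/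
def mfun (κ : ℝ) : ℝ := Real.smoothTransition (4 * κ - 1)

/-- `mfun` is smooth. -/
theorem mfun_contDiff : ContDiff ℝ ∞ mfun :=
  Real.smoothTransition.contDiff.comp ((contDiff_const.mul contDiff_id).sub contDiff_const)

/-- `mfun 0 = 0`. -/
theorem mfun_zero : mfun 0 = 0 := Real.smoothTransition.zero_of_nonpos (by norm_num)

/-- `mfun κ = 1` for `κ ≥ 1/2`. -/
theorem mfun_eq_one {κ : ℝ} (h : 1 / 2 ≤ κ) : mfun κ = 1 :=
  Real.smoothTransition.one_of_one_le (by linarith)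

/-- `mfun` takes values in `[0, 1]`. -/
theorem mfun_mem (κ : ℝ) : mfun κ ∈ Icc (0:ℝ) 1 :=
  ⟨Real.smoothTransition.nonneg _, Real.smoothTransition.le_one _⟩

/-- The scale function `λ(κ) = λ₀ + (1 - λ₀) ST(4κ - 3)`: smooth, `λ₀` on `(-∞, 3/4]`, `1` at `1`,
values in `[λ₀, 1]` when `λ₀ ≤ 1`. -/
def lfun (l0 κ : ℝ) : ℝ := l0 + (1 - l0) * Real.smoothTransition (4 * κ - 3)

/-- `lfun l0` is smooth. -/
theorem lfun_contDiff (l0 : ℝ) : ContDiff ℝ ∞ (lfun l0) :=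
  contDiff_const.add (contDiff_const.mul
    (Real.smoothTransition.contDiff.comp ((contDiff_const.mul contDiff_id).sub contDiff_const)))

/-- `lfun l0 κ = l0` for `κ ≤ 3/4`. -/
theorem lfun_eq_of_le {l0 κ : ℝ} (h : κ ≤ 3 / 4) : lfun l0 κ = l0 := by
  rw [lfun, Real.smoothTransition.zero_of_nonpos (by linarith), mul_zero, add_zero]

/-- `lfun l0 1 = 1`. -/
theorem lfun_one (l0 : ℝ) : lfun l0 1 = 1 := by
  rw [lfun, Real.smoothTransition.one_of_one_le (by norm_num)]; ring

/-- `l0 ≤ lfun l0 κ` when `l0 ≤ 1`. -/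
theorem lfun_ge {l0 : ℝ} (hl : l0 ≤ 1) (κ : ℝ) : l0 ≤ lfun l0 κ := by
  have := Real.smoothTransition.nonneg (4 * κ - 3)
  unfold lfun; nlinarith

/-- `lfun l0 κ ≤ 1` when `l0 ≤ 1`. -/
theorem lfun_le_one {l0 : ℝ} (hl : l0 ≤ 1) (κ : ℝ) : lfun l0 κ ≤ 1 := by
  have := Real.smoothTransition.le_one (4 * κ - 3)
  unfold lfun; nlinarith


/-- A two-sided inverse of a strictly monotone function is monotone on the range where it is an
inverse. [folklore] -/
theorem ginv_monotone {G Ginv : ℝ → ℝ} {S : Set ℝ} (hG : StrictMonoOn G S) {y₁ y₂ : ℝ}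
    (h₁ : G (Ginv y₁) = y₁ ∧ Ginv y₁ ∈ S) (h₂ : G (Ginv y₂) = y₂ ∧ Ginv y₂ ∈ S) (h : y₁ ≤ y₂) :
    Ginv y₁ ≤ Ginv y₂ := by
  by_contra hlt
  push Not at hlt
  have := hG h₂.2 h₁.2 hlt
  rw [h₁.1, h₂.1] at this
  exact absurd h (not_le.2 this)

/-- **Two-chart smoothness of the plateau-glued family** (generic in the field type `X` and in the
outer scaling map `g`). Chart 1 (`κ < 3/4`): the slowed interpolation member
`g l0 (W (mfun κ) (l0 s) x)`; chart 2 (`κ > 1/2`): the scaled target `g (lfun l0 κ) (w (lfun l0 κ · s) x)`;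
on the overlap `1/2 < κ < 3/4` both plateaus are flat (`mfun = 1`, `lfun = l0`) and the two formulas
coincide literally thanks to `W 1 = w` on `[0, T₂)`. [this file] -/
theorem family_contDiffOn {X : Type*} [NormedAddCommGroup X] [NormedSpace ℝ X]
    {l0 T T' Tst T₂ : ℝ} (W : ℝ → ℝ → T3 → X) (w : ℝ → T3 → X) (g : ℝ → X → X)
    (Fh : ℝ → ℝ → T3 → X)
    (hg : ContDiff ℝ ∞ (fun p : ℝ × X => g p.1 p.2))
    (hW : ContDiffOn ℝ ∞
      (fun q : ℝ × ℝ × EuclideanSpace ℝ (Fin 3) => W q.1 q.2.1 (Torus.proj q.2.2))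
      (Icc 0 1 ×ˢ (Ico 0 Tst ×ˢ univ)))
    (hw : Torus.IsSmoothSpaceTimeOn (Ico 0 T) w)
    (hl0 : 0 < l0) (hl01 : l0 ≤ 1) (hT₂Tst : T₂ ≤ Tst) (hT'T : T' < T)
    (hl0s : ∀ s ∈ Ico (0:ℝ) T', l0 * s ∈ Ico (0:ℝ) T₂)
    (hover : ∀ s ∈ Ico (0:ℝ) T₂, W 1 s = w s)
    (hFh : ∀ κ s x, Fh κ s x =
      if κ ≤ 5 / 8 then g l0 (W (mfun κ) (l0 * s) x) else g (lfun l0 κ) (w (lfun l0 κ * s) x)) :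
    ContDiffOn ℝ ((⊤ : ℕ∞) : WithTop ℕ∞)
      (fun q : ℝ × ℝ × EuclideanSpace ℝ (Fin 3) => Fh q.1 q.2.1 (Torus.proj q.2.2))
      (Icc 0 1 ×ˢ (Ico 0 T' ×ˢ univ)) := by
  have hlampos : ∀ κ, 0 < lfun l0 κ := fun κ => hl0.trans_le (lfun_ge hl01 κ)
  have hlamle : ∀ κ, lfun l0 κ ≤ 1 := lfun_le_one hl01
  have hDs : ∀ q : ℝ × ℝ × EuclideanSpace ℝ (Fin 3), q ∈ Icc (0:ℝ) 1 ×ˢ (Ico 0 T' ×ˢ univ) →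
      q.1 ∈ Icc (0:ℝ) 1 ∧ q.2.1 ∈ Ico 0 T' := fun q hq =>
    ⟨(mem_prod.1 hq).1, (mem_prod.1 (mem_prod.1 hq).2).1⟩
  -- inner maps of the two charts
  have hψA : ContDiff ℝ ∞ (fun p : ℝ × ℝ × EuclideanSpace ℝ (Fin 3) =>
      ((mfun p.1, l0 * p.2.1, p.2.2) : ℝ × ℝ × EuclideanSpace ℝ (Fin 3))) :=
    (mfun_contDiff.comp contDiff_fst).prodMk
      ((contDiff_const.mul (contDiff_fst.comp contDiff_snd)).prodMk (contDiff_snd.comp contDiff_snd))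
  have hψAmaps : MapsTo (fun p : ℝ × ℝ × EuclideanSpace ℝ (Fin 3) =>
      ((mfun p.1, l0 * p.2.1, p.2.2) : ℝ × ℝ × EuclideanSpace ℝ (Fin 3)))
      (Icc (0:ℝ) 1 ×ˢ (Ico 0 T' ×ˢ univ)) (Icc (0:ℝ) 1 ×ˢ (Ico 0 Tst ×ˢ univ)) := by
    intro p hp
    obtain ⟨_, hs⟩ := hDs p hp
    exact mem_prod.2 ⟨mfun_mem p.1, mem_prod.2 ⟨⟨(hl0s _ hs).1, (hl0s _ hs).2.trans_le hT₂Tst⟩,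
      mem_univ _⟩⟩
  have hψB : ContDiff ℝ ∞ (fun p : ℝ × ℝ × EuclideanSpace ℝ (Fin 3) =>
      ((lfun l0 p.1 * p.2.1, p.2.2) : ℝ × EuclideanSpace ℝ (Fin 3))) :=
    (((lfun_contDiff l0).comp contDiff_fst).mul (contDiff_fst.comp contDiff_snd)).prodMk
      (contDiff_snd.comp contDiff_snd)
  have hψBmaps : MapsTo (fun p : ℝ × ℝ × EuclideanSpace ℝ (Fin 3) =>
      ((lfun l0 p.1 * p.2.1, p.2.2) : ℝ × EuclideanSpace ℝ (Fin 3)))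
      (Icc (0:ℝ) 1 ×ˢ (Ico 0 T' ×ˢ univ)) (Ico 0 T ×ˢ univ) := by
    intro p hp
    obtain ⟨_, hs⟩ := hDs p hp
    refine mem_prod.2 ⟨⟨mul_nonneg (hlampos p.1).le hs.1, ?_⟩, mem_univ _⟩
    calc lfun l0 p.1 * p.2.1 ≤ 1 * p.2.1 := mul_le_mul_of_nonneg_right (hlamle p.1) hs.1
      _ < T := by rw [one_mul]; exact hs.2.trans hT'T
  have hlamD : ContDiffOn ℝ ∞ (fun p : ℝ × ℝ × EuclideanSpace ℝ (Fin 3) => lfun l0 p.1)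
      (Icc (0:ℝ) 1 ×ˢ (Ico 0 T' ×ˢ univ)) := ((lfun_contDiff l0).comp contDiff_fst).contDiffOn
  -- the two chart maps are smooth
  have g₁ : ContDiffOn ℝ ∞ (fun p : ℝ × ℝ × EuclideanSpace ℝ (Fin 3) =>
      g l0 (W (mfun p.1) (l0 * p.2.1) (Torus.proj p.2.2))) (Icc (0:ℝ) 1 ×ˢ (Ico 0 T' ×ˢ univ)) :=
    hg.comp_contDiffOn (contDiffOn_const.prodMk (hW.comp hψA.contDiffOn hψAmaps))
  have g₂ : ContDiffOn ℝ ∞ (fun p : ℝ × ℝ × EuclideanSpace ℝ (Fin 3) =>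
      g (lfun l0 p.1) (w (lfun l0 p.1 * p.2.1) (Torus.proj p.2.2)))
      (Icc (0:ℝ) 1 ×ˢ (Ico 0 T' ×ˢ univ)) :=
    hg.comp_contDiffOn (hlamD.prodMk (hw.comp hψB.contDiffOn hψBmaps))
  refine contDiffOn_of_two_charts g₁ g₂ (fun q hq hlt => ?_) (fun q hq hgt => ?_)
  · show Fh q.1 q.2.1 (Torus.proj q.2.2) = g l0 (W (mfun q.1) (l0 * q.2.1) (Torus.proj q.2.2))
    rw [hFh]
    by_cases hκ : q.1 ≤ 5 / 8
    · rw [if_pos hκ]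
    · rw [if_neg hκ]
      push Not at hκ
      rw [mfun_eq_one (by linarith), lfun_eq_of_le hlt.le, hover _ (hl0s _ (hDs q hq).2)]
  · show Fh q.1 q.2.1 (Torus.proj q.2.2) =
      g (lfun l0 q.1) (w (lfun l0 q.1 * q.2.1) (Torus.proj q.2.2))
    rw [hFh]
    by_cases hκ : q.1 ≤ 5 / 8
    · rw [if_pos hκ]
      rw [mfun_eq_one hgt.le, lfun_eq_of_le (by linarith), hover _ (hl0s _ (hDs q hq).2)]
    · rw [if_neg hκ]

/-- **LLN clause of one member.** With the local equation of state `G` (strictly increasing on the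
working range) the chemical potential of a profile of prescribed activity SHAPE is pinned by the
mass-one normalisation, so the law-of-large-numbers density of `[S]` is the prescribed `d = G (R a)`.
[this file] -/
theorem lln_member {σ B R : ℝ} {G : ℝ → ℝ} {a θ₀ d : T3 → ℝ} {u₀ : T3 → V3}
    {ρh θh : ℝ → T3 → ℝ} {uh : ℝ → T3 → V3}
    (Φ : (N : ℕ) → Literature.Analysis.FluidPDE.HardSphereFlow
      (Literature.Analysis.FluidPDE.Torus.geometry (Fin 3)) (hsDiameter σ N) (N + 1))
    (hGmono : StrictMonoOn G (Icc 0 (8 * B ^ 2))) (hGc : ContinuousOn G (Icc 0 (8 * B ^ 2)))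
    (h2B8 : 2 * B ^ 2 ≤ 8 * B ^ 2)
    (hprof : ∀ (a θ₀ : T3 → ℝ) (u₀ : T3 → V3), Continuous a → Continuous θ₀ → Continuous u₀ →
        (∀ x, B⁻¹ ≤ a x ∧ a x ≤ B) → (∀ x, 0 < θ₀ x) →
        ∃ μ : ℝ, (∫ x, G (Real.exp μ * a x) = 1) ∧
          (∀ x, Real.exp μ * a x ∈ Icc (0:ℝ) (2 * B ^ 2)) ∧
          (∀ x, G (Real.exp μ * a x) ≤ 4 * B ^ 2) ∧
          ∀ Φ : (N : ℕ) → Literature.Analysis.FluidPDE.HardSphereFlow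
              (Literature.Analysis.FluidPDE.Torus.geometry (Fin 3)) (hsDiameter σ N) (N + 1),
            TendstoHydroFieldsAt (fun N => localGibbsLaw σ a u₀ θ₀ N (Φ N)) Φ
              (fun _ x => G (Real.exp μ * a x)) (fun _ => u₀) (fun _ => θ₀) 0)
    (ha : Continuous a) (hθ : Continuous θ₀) (hu : Continuous u₀)
    (haB : ∀ x, B⁻¹ ≤ a x ∧ a x ≤ B) (hθpos : ∀ x, 0 < θ₀ x) (hapos : ∀ x, 0 < a x)
    (hRa : ∀ x, R * a x ∈ Icc (0:ℝ) (8 * B ^ 2)) (hd : ∀ x, G (R * a x) = d x)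
    (hdc : Continuous d) (hdint : ∫ x, d x = 1)
    (hρ0 : ρh 0 = d) (hu0 : uh 0 = u₀) (hθ0 : θh 0 = θ₀) :
    TendstoHydroFieldsAt (fun N => localGibbsLaw σ a u₀ θ₀ N (Φ N)) Φ ρh uh θh 0 := by
  obtain ⟨μ, hμint, hμrng, -, hμlln⟩ := hprof a θ₀ u₀ ha hθ hu haB hθpos
  have hμrng8 : ∀ x, Real.exp μ * a x ∈ Icc (0:ℝ) (8 * B ^ 2) := fun x =>
    ⟨(hμrng x).1, (hμrng x).2.trans h2B8⟩
  have hGμc : Continuous fun x => G (Real.exp μ * a x) :=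
    hGc.comp_continuous (continuous_const.mul ha) hμrng8
  -- uniqueness of the chemical potential: `e^μ = R`
  have hexp : Real.exp μ = R := by
    by_contra hne
    rcases lt_or_gt_of_ne hne with hlt | hgt
    · have hlt' : ∀ x, G (Real.exp μ * a x) < d x := fun x => by
        rw [← hd x]
        exact hGmono (hμrng8 x) (hRa x) (mul_lt_mul_of_pos_right hlt (hapos x))
      have := integral_lt_of_forall_lt hGμc hdc hlt'
      rw [hμint, hdint] at this
      exact lt_irrefl _ this
    · have hgt' : ∀ x, d x < G (Real.exp μ * a x) := fun x => by
        rw [← hd x]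
        exact hGmono (hRa x) (hμrng8 x) (mul_lt_mul_of_pos_right hgt (hapos x))
      have := integral_lt_of_forall_lt hdc hGμc hgt'
      rw [hμint, hdint] at this
      exact lt_irrefl _ this
  refine tendstoHydroFieldsAt_zero_congr (hμlln Φ) ?_ hu0 hθ0
  rw [hρ0]
  funext x
  rw [hexp]
  exact (hd x).symm

/-! ## Small arithmetic / analysis helpers extracted from the kernel (Step 0 and Step 2) -/

/-- Activity bounds: a continuous positive function on `𝕋³` attains its extrema and lies in
`[B⁻¹, B]` for `B = max 1 (max (sup a) (inf a)⁻¹) ≥ 1`. -/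
theorem exists_activity_bounds {a₁ : T3 → ℝ} (ha₁c : Continuous a₁) (ha₁ : ∀ x, 0 < a₁ x) :
    ∃ (B : ℝ) (xalo xahi : T3), 1 ≤ B ∧ (∀ x, a₁ xalo ≤ a₁ x ∧ a₁ x ≤ a₁ xahi) ∧
      (∀ x, B⁻¹ ≤ a₁ x ∧ a₁ x ≤ B) := by
  obtain ⟨xalo, xahi, hab⟩ := exists_min_max ha₁c
  obtain ⟨B, hB_def⟩ : ∃ B : ℝ, B = max 1 (max (a₁ xahi) (a₁ xalo)⁻¹) := ⟨_, rfl⟩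
  have hB1 : 1 ≤ B := hB_def ▸ le_max_left _ _
  refine ⟨B, xalo, xahi, hB1, hab, fun x => ⟨?_, ?_⟩⟩
  · have h1 : (a₁ xalo)⁻¹ ≤ B := hB_def ▸ (le_max_right _ _).trans (le_max_right _ _)
    exact (inv_le_of_inv_le₀ (ha₁ xalo) h1).trans (hab x).1
  · exact (hab x).2.trans (hB_def ▸ (le_max_left _ _).trans (le_max_right _ _))

/-- Packing arithmetic: `σ ≤ 1/2` and `σ < η₁ / (8B²)` give `4B²σ³ ≤ η₁/2`. -/
theorem packing_le_half {σ η₁ B : ℝ} (hσ : 0 < σ) (hσhalf : σ ≤ 1 / 2) (hBpos : 0 < B)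
    (hση : σ < η₁ / (8 * B ^ 2)) : 4 * B ^ 2 * σ ^ 3 ≤ η₁ / 2 := by
  have hσ1 : σ ≤ 1 := by linarith only [hσhalf]
  have hσ3le : σ ^ 3 ≤ σ := pow_le_of_le_one hσ.le hσ1 (by norm_num)
  have hB2 : 0 < B ^ 2 := pow_pos hBpos 2
  have h8 : σ * (8 * B ^ 2) < η₁ := (lt_div_iff₀ (by positivity)).1 hση
  have h1 := mul_le_mul_of_nonneg_left hσ3le (by positivity : (0:ℝ) ≤ 4 * B ^ 2)
  linarith only [h1, h8]

/-- Convex interpolation of a unit-mass continuous density with the constant `1` has mass one. -/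
theorem integral_convexComb_eq_one {ρ₀ : T3 → ℝ} (hρ₀c : Continuous ρ₀) (hρ₀int : ∫ x, ρ₀ x = 1)
    (m : ℝ) : ∫ x, ((1 - m) + m * ρ₀ x) = 1 := by
  rw [integral_add (integrable_const _) ((integrable_of_continuous_T3 hρ₀c).const_mul m),
    integral_const_mul, hρ₀int]
  simp

/-- Packing arithmetic: `d ≤ 4B²`, `4B²σ³ ≤ η₁/2`, `η₁ ≤ η₁'`, `0 < η₁` give `d σ³ ≤ η₁'`. -/
theorem packing_of_le {d B σ η₁ η₁' : ℝ} (h1 : d ≤ 4 * B ^ 2) (hσ3pos : 0 < σ ^ 3)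
    (hσ3 : 4 * B ^ 2 * σ ^ 3 ≤ η₁ / 2) (hle : η₁ ≤ η₁') (hη₁ : 0 < η₁) : d * σ ^ 3 ≤ η₁' := by
  have h2 : d * σ ^ 3 ≤ 4 * B ^ 2 * σ ^ 3 := mul_le_mul_of_nonneg_right h1 hσ3pos.le
  linarith only [h2, hσ3, hle, hη₁]


end Summit.AtomisticToContinuum.HydrodynamicLimit.Theorems.PreShockDoor

end
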